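import Mathlib.MeasureTheory.Measure.Lebesgue.EqHaar
import Mathlib.MeasureTheory.Measure.Haar.InnerProductSpace
import Mathlib.MeasureTheory.Integral.MeanInequalities
import Mathlib.MeasureTheory.Integral.Lebesgue.Countable
import Mathlib.MeasureTheory.Function.LpSeminorm.Basic
import Mathlib.Analysis.MeanInequalitiesPow
import Mathlib.Analysis.SpecialFunctions.Pow.Continuity
import Mathlib.Analysis.SpecificLimits.Basic
import Mathlib.Data.Int.Log
import HarnessLib

/-!
# The fractional Gagliardo–Sobolev inequality `‖f‖_{L^{p⋆}} ≲ [f]_{W^{s,p}}` on `ℝⁿ`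
# (Di Nezza–Palatucci–Valdinoci 2012, §6, Theorem 6.5; elementary proof of Savin–Valdinoci)

Topic `Analysis/FunctionSpaces`. Theorems only: no definitions, no named facts, no `sorry`.

For `0 < s < 1`, `1 ≤ p`, `s p < n` and the *fractional critical exponent* `p⋆ = n p / (n − s p)`,
Di Nezza–Palatucci–Valdinoci, *Hitchhiker's guide to the fractional Sobolev spaces*, Bull. Sci. Math.
136 (2012), **Theorem 6.5** states: there is `C = C(n,p,s)` such that for every measurable, compactly
supported `f : ℝⁿ → ℝ`

  `‖f‖_{L^{p⋆}(ℝⁿ)}^p ≤ C ∫_{ℝⁿ} ∫_{ℝⁿ} |f(x) − f(y)|^p / |x − y|^{n + s p} dx dy`,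

the right-hand side being the `p`-th power of the Gagliardo (Aronszajn–Slobodeckij) seminorm
`[f]_{W^{s,p}(ℝⁿ)}` (ibid. §2, (2.1)).  We prove it (`exists_lintegral_rpow_enorm_le_mul_gagliardo`) on any
finite-dimensional real normed space `E` of dimension `n ≥ 1` with an additive Haar measure `μ`, for
functions with values in any normed group `F`, written with lower Lebesgue integrals in `ℝ≥0∞`:

  `(∫⁻ ‖f x‖ₑ ^ p⋆ ∂μ) ^ ((n − s p)/n) ≤ C ∫⁻ x, ∫⁻ y, ‖f x − f y‖ₑ ^ p / ‖x − y‖ₑ ^ (n + s p) ∂μ ∂μ`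

(note `p / p⋆ = (n − s p)/n`), under the hypothesis `μ (support f) < ∞` — which is what the printed
"compactly supported" is used for — and for `AEStronglyMeasurable f`; the printed form (compact support)
is `exists_lintegral_rpow_enorm_le_mul_gagliardo_of_hasCompactSupport`, the `L^{p⋆}`-seminorm form is
`exists_eLpNorm_le_mul_gagliardo_rpow`, and the case `(n, s, p, p⋆) = (3, ½, 2, 3)` on `ℝ³`
(`Ḣ^{1/2}`-Gagliardo energy controls `L³`) is `exists_lintegral_cube_le_mul_gagliardo_R3`.

## The proof (ibid. §6, followed step by step)

* `lemma_6_1` — **Lemma 6.1**: `∫_{∁A} dy/|x−y|^{n+t} ≥ c |A|^{−t/n}` for `0 < |A| < ∞` (rearrangement onto the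
  ball `B(x,ρ)` with `|B(x,ρ)| = |A|`, then the shell `B(x,2ρ) ∖ B(x,ρ)` instead of polar coordinates;
  `c = 2^{−(n+t)} |B₁|^{1+t/n}`).
* `lemma_6_2` — **Lemma 6.2**, the discrete summability lemma (Hölder with exponents `n/(sp)`, `n/(n−sp)` on
  the counting measure of `ℤ`), in `ℝ≥0∞`, with constant `T^{n/(n−sp)}`.
* `level_estimate` + `tsum_level_le_gagliardo` — **Lemma 6.3** (`a_k = |{|f| > 2^k}|`,
  `d_k = |{2^k < |f| ≤ 2^{k+1}}|`): `∑_k 2^{pk} a_{k+1} a_k^{−sp/n} ≲ [f]^p_{W^{s,p}}`.  We organise the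
  bookkeeping additively (`a_{k} = ∑_{ℓ ≥ k} d_ℓ`, swap the sums, bound the geometric tail), which avoids
  the subtraction step of the printed proof and needs no boundedness of `f` at this point.
* `lintegral_rpow_le_mul_gagliardo_of_bounded` — Theorem 6.5 for bounded `f ≥ 0` with `|support f| < ∞`
  (layer-cake bound `‖f‖^{p⋆}_{p⋆} ≤ ∑_k 2^{(k+1)p⋆} a_k`, subadditivity of `t ↦ t^{(n−sp)/n}`, Lemma 6.2,
  Lemma 6.3), then the truncation `f_N = min(f, 2^N)` and monotone convergence (the printed Lemma 6.4 /
  dominated-convergence step; truncation is `1`-Lipschitz so `[f_N] ≤ [f]` termwise), then the reduction of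
  an `F`-valued `f` to `‖f‖` (`| ‖f x‖ − ‖f y‖ | ≤ ‖f x − f y‖`, the first line of the proof of Lemma 6.3).

The hypothesis `1 ≤ p` is the printed one; the argument uses only `0 < p` and the intermediate
statements are proved in that generality.  What is NOT here: the embeddings `W^{s,p} ↪ L^q`,
`q ∈ [p, p⋆]` (Hölder interpolation), Theorem 6.7 (extension domains), Theorems 6.9–6.10 (`sp = n`,
`sp > n`), and the Fourier characterisation of `[·]_{W^{s,2}}` (ibid. Prop. 3.4).  Different objects in
the tree: the Fourier-side `Ḣ^s(ℝ³) ⊂ L^{6/(3−2s)}` (`FourierSobolevNormEmbeddingSubcritical.lean`,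
`eLpNorm_le_eHomSobolevSeminorm_of_lt_threeHalves`), the torus version
(`TorusFractionalSobolevEmbedding.lean`), the integer-order Gagliardo–Nirenberg–Sobolev inequality
(`GagliardoNirenbergSobolev.lean`) and Brezis' constancy criterion (`BrezisConstantFunctions.lean`,
kernel exponent `n + p`, i.e. `s = 1`).

Motivation (consumer): the `Ḣ^{1/2}`-level window budgets of the Navier–Stokes door routes
(weighted Gagliardo form `¼∬(a(x)+a(y)) π⁻²‖x−y‖⁻⁴‖v(x)−v(y)‖²` on `ℝ³`), whose step
"uniform windowed Gagliardo bound ⇒ `L³(B₁)` bound" is this theorem applied to a cut-off of the field.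
-/

open MeasureTheory Metric Set Filter
open scoped ENNReal NNReal Topology

namespace Literature.Analysis.FunctionSpaces

namespace DiNezzaPalatucciValdinoci2012

/-! ### Discrete tools in `ℝ≥0∞` -/

/-- Subadditivity of `t ↦ t ^ γ` (`0 < γ ≤ 1`) over finite sums in `ℝ≥0∞`. [folklore] -/
private theorem rpow_sum_le_sum_rpow {ι : Type*} (s : Finset ι) (f : ι → ℝ≥0∞) {γ : ℝ} (hγ0 : 0 < γ)
    (hγ1 : γ ≤ 1) : (∑ i ∈ s, f i) ^ γ ≤ ∑ i ∈ s, f i ^ γ := by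
  classical
  induction s using Finset.induction_on with
  | empty => simp [ENNReal.zero_rpow_of_pos hγ0]
  | insert a s ha ih =>
    rw [Finset.sum_insert ha, Finset.sum_insert ha]
    exact (ENNReal.rpow_add_le_add_rpow _ _ hγ0.le hγ1).trans (add_le_add le_rfl ih)

/-- Subadditivity of `t ↦ t ^ γ` (`0 < γ ≤ 1`) over arbitrary sums in `ℝ≥0∞`. [folklore] -/
private theorem rpow_tsum_le_tsum_rpow {ι : Type*} (f : ι → ℝ≥0∞) {γ : ℝ} (hγ0 : 0 < γ) (hγ1 : γ ≤ 1) :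
    (∑' i, f i) ^ γ ≤ ∑' i, f i ^ γ := by
  have h : (⨆ s : Finset ι, ∑ i ∈ s, f i) ^ γ = ⨆ s : Finset ι, (∑ i ∈ s, f i) ^ γ :=
    (ENNReal.orderIsoRpow γ hγ0).map_iSup _
  rw [ENNReal.tsum_eq_iSup_sum, h]
  exact iSup_le fun s => (rpow_sum_le_sum_rpow s f hγ0 hγ1).trans (ENNReal.sum_le_tsum s)

/-- Hölder's inequality for sums over `ℤ` in `ℝ≥0∞` (the counting-measure case of
`ENNReal.lintegral_mul_le_Lp_mul_Lq`). [folklore] -/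
private theorem tsum_mul_le_Lp_mul_Lq {α β : ℝ} (hαβ : α.HolderConjugate β) (F G : ℤ → ℝ≥0∞) :
    ∑' k, F k * G k ≤ (∑' k, F k ^ α) ^ (1 / α) * (∑' k, G k ^ β) ^ (1 / β) := by
  have h := ENNReal.lintegral_mul_le_Lp_mul_Lq (Measure.count : Measure ℤ) hαβ
    (f := F) (g := G) (Measurable.of_discrete).aemeasurable (Measurable.of_discrete).aemeasurable
  simpa only [lintegral_count, Pi.mul_apply] using h

/-- Geometric tail over the integers `i ≤ ℓ`: `∑_{i ≤ ℓ} T^i = T^ℓ (1 − T⁻¹)⁻¹` in `ℝ≥0∞` (real exponents,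
`T ≠ 0, ∞`; the value is `∞` when `T ≤ 1`). [folklore] -/
private theorem tsum_ite_le_rpow_eq {T : ℝ≥0∞} (hT0 : T ≠ 0) (hTtop : T ≠ ⊤) (ℓ : ℤ) :
    ∑' i : ℤ, (if i ≤ ℓ then T ^ (i : ℝ) else 0) = T ^ (ℓ : ℝ) * (1 - T⁻¹)⁻¹ := by
  have h1 : ∑' i : ℤ, (if i ≤ ℓ then T ^ (i : ℝ) else 0) =
      ∑' x : ({i : ℤ | i ≤ ℓ} : Set ℤ), T ^ ((x : ℤ) : ℝ) := by
    rw [tsum_subtype {i : ℤ | i ≤ ℓ} (fun i : ℤ => T ^ (i : ℝ))]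
    refine tsum_congr fun i => ?_
    simp only [Set.indicator_apply, Set.mem_setOf_eq]
  let e : ℕ ≃ ({i : ℤ | i ≤ ℓ} : Set ℤ) :=
    { toFun := fun m => ⟨ℓ - m, by show ℓ - (m : ℤ) ≤ ℓ; omega⟩
      invFun := fun i => (ℓ - i.1).toNat
      left_inv := fun m => by simp
      right_inv := fun i => by
        obtain ⟨i, hi⟩ := i
        have hi' : i ≤ ℓ := hi
        ext
        simp only [Int.toNat_of_nonneg (sub_nonneg.2 hi')]
        ring }
  have h2 : ∑' x : ({i : ℤ | i ≤ ℓ} : Set ℤ), T ^ ((x : ℤ) : ℝ) = ∑' m : ℕ, T ^ (ℓ : ℝ) * T⁻¹ ^ m := by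
    rw [← e.tsum_eq]
    refine tsum_congr fun m => ?_
    show T ^ (((ℓ - m : ℤ)) : ℝ) = _
    rw [Int.cast_sub, Int.cast_natCast, ENNReal.rpow_sub _ _ hT0 hTtop, ENNReal.rpow_natCast,
      div_eq_mul_inv, ENNReal.inv_pow]
  rw [h1, h2, ENNReal.tsum_mul_left, ENNReal.tsum_geometric]

/-- In `ℝ≥0∞`, `x ↦ x ^ (−θ)` is antitone for `0 ≤ θ`. [folklore] -/
private theorem rpow_neg_le_rpow_neg_of_le {x y : ℝ≥0∞} (h : x ≤ y) {θ : ℝ} (hθ : 0 ≤ θ) :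
    y ^ (-θ) ≤ x ^ (-θ) := by
  rw [ENNReal.rpow_neg, ENNReal.rpow_neg]
  exact ENNReal.inv_le_inv.2 (ENNReal.rpow_le_rpow h hθ)

/-- **Lemma 6.2** of Di Nezza–Palatucci–Valdinoci (the discrete summability lemma), in `ℝ≥0∞` and with
the constant made explicit: for `0 < θ < 1`, `T ∈ (0, ∞)` and an antitone finite-valued sequence
`a : ℤ → [0,∞)`, if `L = ∑_k T^k a_k^{1−θ} < ∞` then `L ≤ T^{1/(1−θ)} ∑_k T^k a_{k+1} a_k^{−θ}`.
Printed with `1 − θ = (n−sp)/n`, `θ = sp/n` and the hypothesis "`a_k = 0` for `k ≥ N`", which serves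
to make both series convergent; the printed restriction of the right-hand sum to `a_k ≠ 0` is automatic in
`ℝ≥0∞`, where `a_k = 0` forces `a_{k+1} = 0` and `0 · 0^{−θ} = 0 · ∞ = 0`.
[cite: DinezzaPalatucciValdinoci2012, Lemma 6.2] -/
theorem lemma_6_2 {θ : ℝ} (hθ0 : 0 < θ) (hθ1 : θ < 1) {T : ℝ≥0∞} (hT0 : T ≠ 0) (hTtop : T ≠ ⊤)
    {a : ℤ → ℝ≥0∞} (ha : Antitone a) (hatop : ∀ k, a k ≠ ⊤)
    (hL : ∑' k : ℤ, T ^ (k : ℝ) * a k ^ (1 - θ) ≠ ⊤) :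
    ∑' k : ℤ, T ^ (k : ℝ) * a k ^ (1 - θ) ≤
      T ^ (1 / (1 - θ)) * ∑' k : ℤ, T ^ (k : ℝ) * (a (k + 1) * a k ^ (-θ)) := by
  set L := ∑' k : ℤ, T ^ (k : ℝ) * a k ^ (1 - θ) with hLdef
  set R := ∑' k : ℤ, T ^ (k : ℝ) * (a (k + 1) * a k ^ (-θ)) with hRdef
  have h1θ : 0 < 1 - θ := sub_pos.2 hθ1
  have hθne : θ ≠ 0 := hθ0.ne'
  have h1θne : 1 - θ ≠ 0 := h1θ.ne'
  -- (1) the shifted sum is `T⁻¹ L`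
  have hshift : T⁻¹ * L = ∑' k : ℤ, T ^ (k : ℝ) * a (k + 1) ^ (1 - θ) := by
    have hL' : L = ∑' k : ℤ, T ^ ((k + 1 : ℤ) : ℝ) * a (k + 1) ^ (1 - θ) :=
      ((Equiv.addRight (1 : ℤ)).tsum_eq (fun j => T ^ (j : ℝ) * a j ^ (1 - θ))).symm
    rw [hL', ← ENNReal.tsum_mul_left]
    refine tsum_congr fun k => ?_
    rw [Int.cast_add, Int.cast_one, ENNReal.rpow_add _ _ hT0 hTtop, ENNReal.rpow_one,
      mul_comm (T ^ (k : ℝ)) T, mul_assoc T, ← mul_assoc T⁻¹, ENNReal.inv_mul_cancel hT0 hTtop,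
      one_mul]
  -- (2) Hölder with the exponents `1/θ`, `1/(1-θ)`
  have hconj : (1 / θ).HolderConjugate (1 / (1 - θ)) :=
    Real.holderConjugate_one_div hθ0 h1θ (by ring)
  set F : ℤ → ℝ≥0∞ := fun k => T ^ ((k : ℝ) * θ) * a k ^ (θ * (1 - θ)) with hFdef
  set G : ℤ → ℝ≥0∞ :=
    fun k => T ^ ((k : ℝ) * (1 - θ)) * (a (k + 1) ^ (1 - θ) * a k ^ (-(θ * (1 - θ)))) with hGdef
  have hFpow : ∀ k : ℤ, F k ^ (1 / θ) = T ^ (k : ℝ) * a k ^ (1 - θ) := by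
    intro k
    simp only [hFdef]
    rw [ENNReal.mul_rpow_of_nonneg _ _ (by positivity), ← ENNReal.rpow_mul, ← ENNReal.rpow_mul]
    have e1 : (k : ℝ) * θ * (1 / θ) = k := by field_simp
    have e2 : θ * (1 - θ) * (1 / θ) = 1 - θ := by field_simp
    rw [e1, e2]
  have hGpow : ∀ k : ℤ, G k ^ (1 / (1 - θ)) = T ^ (k : ℝ) * (a (k + 1) * a k ^ (-θ)) := by
    intro k
    simp only [hGdef]
    rw [ENNReal.mul_rpow_of_nonneg _ _ (by positivity), ENNReal.mul_rpow_of_nonneg _ _ (by positivity),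
      ← ENNReal.rpow_mul, ← ENNReal.rpow_mul, ← ENNReal.rpow_mul]
    have e1 : (k : ℝ) * (1 - θ) * (1 / (1 - θ)) = k := by field_simp
    have e2 : (1 - θ) * (1 / (1 - θ)) = 1 := by field_simp
    have e3 : -(θ * (1 - θ)) * (1 / (1 - θ)) = -θ := by field_simp
    rw [e1, e2, e3, ENNReal.rpow_one]
  have hterm : ∀ k : ℤ, T ^ (k : ℝ) * a (k + 1) ^ (1 - θ) ≤ F k * G k := by
    intro k
    by_cases hk : a k = 0
    · have hk1 : a (k + 1) = 0 := le_antisymm (hk ▸ ha (by omega)) (zero_le)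
      rw [hk1, ENNReal.zero_rpow_of_pos h1θ, mul_zero]
      exact zero_le
    · apply le_of_eq
      simp only [hFdef, hGdef]
      have hT : T ^ ((k : ℝ) * θ) * T ^ ((k : ℝ) * (1 - θ)) = T ^ (k : ℝ) := by
        rw [← ENNReal.rpow_add _ _ hT0 hTtop]; congr 1; ring
      have hA : a k ^ (θ * (1 - θ)) * a k ^ (-(θ * (1 - θ))) = 1 := by
        rw [← ENNReal.rpow_add _ _ hk (hatop k), add_neg_cancel, ENNReal.rpow_zero]
      calc T ^ (k : ℝ) * a (k + 1) ^ (1 - θ)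
          = (T ^ ((k : ℝ) * θ) * T ^ ((k : ℝ) * (1 - θ))) *
              (a k ^ (θ * (1 - θ)) * a k ^ (-(θ * (1 - θ)))) * a (k + 1) ^ (1 - θ) := by
            rw [hT, hA, mul_one]
        _ = _ := by ring
  have hholder := tsum_mul_le_Lp_mul_Lq hconj F G
  simp only [hFpow, hGpow, one_div_one_div] at hholder
  have hmain : T⁻¹ * L ≤ L ^ θ * R ^ (1 - θ) := by
    rw [hshift]
    exact (ENNReal.tsum_le_tsum hterm).trans hholder
  -- (3) divide by `L^θ` and raise to the power `1/(1-θ)`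
  by_cases hL0 : L = 0
  · rw [hL0]; exact zero_le
  have hLθ0 : L ^ θ ≠ 0 := by simp [ENNReal.rpow_eq_zero_iff, hL0, hL, hθ0.le.not_gt]
  have hLθtop : L ^ θ ≠ ⊤ := ENNReal.rpow_ne_top_of_nonneg hθ0.le hL
  have hsplit : L = L ^ θ * L ^ (1 - θ) := by
    rw [← ENNReal.rpow_add _ _ hL0 hL, add_sub_cancel, ENNReal.rpow_one]
  have h4 : T⁻¹ * L ^ (1 - θ) ≤ R ^ (1 - θ) := by
    have : L ^ θ * (T⁻¹ * L ^ (1 - θ)) ≤ L ^ θ * R ^ (1 - θ) := by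
      calc L ^ θ * (T⁻¹ * L ^ (1 - θ)) = T⁻¹ * (L ^ θ * L ^ (1 - θ)) := by ring
        _ = T⁻¹ * L := by rw [← hsplit]
        _ ≤ L ^ θ * R ^ (1 - θ) := hmain
    exact (ENNReal.mul_le_mul_iff_right hLθ0 hLθtop).1 this
  have h5 : L ^ (1 - θ) ≤ T * R ^ (1 - θ) := by
    calc L ^ (1 - θ) = T * (T⁻¹ * L ^ (1 - θ)) := by
          rw [← mul_assoc, ENNReal.mul_inv_cancel hT0 hTtop, one_mul]
      _ ≤ T * R ^ (1 - θ) := by gcongr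
  have h6 : (L ^ (1 - θ)) ^ (1 / (1 - θ)) ≤ (T * R ^ (1 - θ)) ^ (1 / (1 - θ)) :=
    ENNReal.rpow_le_rpow h5 (by positivity)
  rw [← ENNReal.rpow_mul, mul_one_div_cancel h1θne, ENNReal.rpow_one,
    ENNReal.mul_rpow_of_nonneg _ _ (by positivity), ← ENNReal.rpow_mul,
    mul_one_div_cancel h1θne, ENNReal.rpow_one] at h6
  exact h6

/-- Powers of two: `(2^k : ℝ≥0)^p = (2^p)^k` in `ℝ≥0∞`, `k : ℤ`, `p : ℝ`. [folklore] -/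
private theorem coe_two_zpow_rpow (k : ℤ) (p : ℝ) :
    (((2 : ℝ≥0) ^ k : ℝ≥0) : ℝ≥0∞) ^ p = ((2 : ℝ≥0∞) ^ p) ^ (k : ℝ) := by
  rw [ENNReal.coe_zpow two_ne_zero, ENNReal.coe_ofNat, ← ENNReal.rpow_intCast, ← ENNReal.rpow_mul,
    ← ENNReal.rpow_mul, mul_comm]

/-! ### Lemma 6.1: the kernel integral off a set of finite measure -/

section Kernel

variable {E : Type*} [NormedAddCommGroup E] [NormedSpace ℝ E] [FiniteDimensional ℝ E]
  [MeasurableSpace E] [BorelSpace E] (μ : Measure E) [μ.IsAddHaarMeasure]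

omit [NormedSpace ℝ E] [FiniteDimensional ℝ E] [BorelSpace E] in
/-- Measurability of the kernel `y ↦ (‖x − y‖ₑ^N)⁻¹`. [folklore] -/
private theorem measurable_kernel [OpensMeasurableSpace E] (N : ℝ) (x : E) :
    Measurable fun y : E => (edist x y ^ N)⁻¹ :=
  (ENNReal.continuous_rpow_const.comp (continuous_const.edist continuous_id)).measurable.inv

/-- **Lemma 6.1** of Di Nezza–Palatucci–Valdinoci (after Savin–Valdinoci): for a measurable set `A ⊂ ℝⁿ`
with `0 < |A| < ∞`, every `x` and `t > 0` (printed: `t = sp`),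
`∫_{∁A} dy / |x − y|^{n+t} ≥ c |A|^{−t/n}` with `c = c(n,t) > 0`; here on a real normed space `E` of
dimension `n ≥ 1` with an additive Haar measure `μ`, with the explicit constant
`c = 2^{−(n+t)} μ(B₁)^{1 + t/n}` (the printed proof ends with polar coordinates; we use the shell
`B(x,2ρ) ∖ B(x,ρ)` instead, where `μ(B(x,ρ)) = μ(A)`). [cite: DinezzaPalatucciValdinoci2012, Lemma 6.1] -/
theorem lemma_6_1 (hn : 0 < Module.finrank ℝ E) {t : ℝ} (ht : 0 < t) {A : Set E}
    (hA : MeasurableSet A) (hA0 : μ A ≠ 0) (hAtop : μ A ≠ ⊤) (x : E) :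
    (2 : ℝ≥0∞) ^ (-((Module.finrank ℝ E : ℝ) + t)) *
        μ (ball (0 : E) 1) ^ (1 + t / (Module.finrank ℝ E : ℝ)) *
        μ A ^ (-(t / (Module.finrank ℝ E : ℝ))) ≤
      ∫⁻ y in Aᶜ, (edist x y ^ ((Module.finrank ℝ E : ℝ) + t))⁻¹ ∂μ := by
  set n : ℕ := Module.finrank ℝ E with hn_def
  set N : ℝ := (n : ℝ) + t with hN
  set b : ℝ≥0∞ := μ (ball (0 : E) 1) with hb
  set m : ℝ≥0∞ := μ A with hm
  haveI : Nontrivial E := Module.nontrivial_of_finrank_pos hn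
  have hn0 : (n : ℝ) ≠ 0 := by exact_mod_cast hn.ne'
  have hnpos : (0 : ℝ) < n := by exact_mod_cast hn
  have hN0 : 0 < N := by positivity
  have hb0 : b ≠ 0 := (measure_ball_pos μ (0 : E) one_pos).ne'
  have hbtop : b ≠ ⊤ := measure_ball_lt_top.ne
  -- the radius `ρ` with `μ (ball x ρ) = μ A`
  set ρ : ℝ := (m.toReal / b.toReal) ^ (1 / (n : ℝ)) with hρ
  have hmb : 0 < m.toReal / b.toReal :=
    div_pos (ENNReal.toReal_pos hA0 hAtop) (ENNReal.toReal_pos hb0 hbtop)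
  have hρpos : 0 < ρ := Real.rpow_pos_of_pos hmb _
  have hρn : ρ ^ n = m.toReal / b.toReal := by
    rw [hρ, ← Real.rpow_natCast, ← Real.rpow_mul hmb.le, one_div_mul_cancel hn0, Real.rpow_one]
  set r : ℝ≥0∞ := ENNReal.ofReal ρ with hr
  have hr0 : r ≠ 0 := (ENNReal.ofReal_pos.2 hρpos).ne'
  have hrtop : r ≠ ⊤ := ENNReal.ofReal_ne_top
  have hρb : ENNReal.ofReal (ρ ^ n) * b = m := by
    rw [hρn, ENNReal.ofReal_div_of_pos (ENNReal.toReal_pos hb0 hbtop), ENNReal.ofReal_toReal hAtop,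
      ENNReal.ofReal_toReal hbtop, ENNReal.div_mul_cancel hb0 hbtop]
  have hrn : r ^ (n : ℝ) = m / b := by
    rw [hr, ENNReal.rpow_natCast, ← ENNReal.ofReal_pow hρpos.le, hρn,
      ENNReal.ofReal_div_of_pos (ENNReal.toReal_pos hb0 hbtop), ENNReal.ofReal_toReal hAtop,
      ENNReal.ofReal_toReal hbtop]
  have hball1 : μ (ball x ρ) = m := by
    rw [Measure.addHaar_ball μ x hρpos.le]; exact hρb
  have hball2 : μ (ball x (2 * ρ)) = 2 ^ n * m := by
    rw [Measure.addHaar_ball μ x (by positivity), mul_pow, ENNReal.ofReal_mul (by positivity),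
      ENNReal.ofReal_pow zero_le_two, ENNReal.ofReal_ofNat, mul_assoc]
    exact congrArg _ hρb
  have h2r : (2 : ℝ≥0∞) * r = ENNReal.ofReal (2 * ρ) := by
    rw [ENNReal.ofReal_mul zero_le_two, ENNReal.ofReal_ofNat]
  -- the kernel and its monotonicity in the distance
  set K : E → ℝ≥0∞ := fun y => (edist x y ^ N)⁻¹ with hK
  have hK_in : ∀ y ∈ ball x ρ, (r ^ N)⁻¹ ≤ K y := by
    intro y hy
    simp only [hK]
    refine ENNReal.inv_le_inv.2 (ENNReal.rpow_le_rpow ?_ hN0.le)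
    rw [mem_ball'] at hy
    rw [edist_dist]
    exact ENNReal.ofReal_le_ofReal hy.le
  have hK_out : ∀ y ∈ (ball x ρ)ᶜ, K y ≤ (r ^ N)⁻¹ := by
    intro y hy
    simp only [hK]
    refine ENNReal.inv_le_inv.2 (ENNReal.rpow_le_rpow ?_ hN0.le)
    rw [mem_compl_iff, mem_ball'] at hy
    rw [edist_dist]
    exact ENNReal.ofReal_le_ofReal (not_lt.1 hy)
  have hK_in2 : ∀ y ∈ ball x (2 * ρ), ((2 * r) ^ N)⁻¹ ≤ K y := by
    intro y hy
    simp only [hK]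
    refine ENNReal.inv_le_inv.2 (ENNReal.rpow_le_rpow ?_ hN0.le)
    rw [mem_ball'] at hy
    rw [edist_dist, h2r]
    exact ENNReal.ofReal_le_ofReal hy.le
  -- (i) rearrangement: `∫_{∁A} K ≥ ∫_{∁B} K` for the ball `B = B(x,ρ)` of the same measure as `A`
  set B := ball x ρ with hB
  have hBm : MeasurableSet B := measurableSet_ball
  have hAB : μ (B \ A) = μ (A \ B) := by
    have h1 : μ (A ∩ B) + μ (B \ A) = m := by
      rw [Set.inter_comm, ← hball1]; exact measure_inter_add_sdiff B hA
    have h2 : μ (A ∩ B) + μ (A \ B) = m := measure_inter_add_sdiff A hBm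
    have hfin : μ (A ∩ B) ≠ ⊤ := ((measure_mono Set.inter_subset_left).trans_lt hAtop.lt_top).ne
    exact (ENNReal.add_right_inj hfin).1 (h1.trans h2.symm)
  have hstep1 : ∫⁻ y in Bᶜ, K y ∂μ ≤ ∫⁻ y in Aᶜ, K y ∂μ := by
    have e1 : Bᶜ ∩ A = A \ B := by
      ext y; simp only [Set.mem_inter_iff, Set.mem_compl_iff, Set.mem_sdiff]; tauto
    have e2 : Bᶜ \ A = Aᶜ \ B := by
      ext y; simp only [Set.mem_compl_iff, Set.mem_sdiff]; tauto
    have e3 : Aᶜ ∩ B = B \ A := by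
      ext y; simp only [Set.mem_inter_iff, Set.mem_compl_iff, Set.mem_sdiff]; tauto
    rw [← lintegral_inter_add_sdiff K Bᶜ hA, ← lintegral_inter_add_sdiff K Aᶜ hBm, e1, e2, e3]
    refine add_le_add ?_ le_rfl
    calc ∫⁻ y in A \ B, K y ∂μ ≤ ∫⁻ y in A \ B, (r ^ N)⁻¹ ∂μ :=
          setLIntegral_mono' (hA.diff hBm) fun y hy => hK_out y hy.2
      _ = (r ^ N)⁻¹ * μ (A \ B) := setLIntegral_const _ _
      _ = (r ^ N)⁻¹ * μ (B \ A) := by rw [hAB]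
      _ = ∫⁻ y in B \ A, (r ^ N)⁻¹ ∂μ := (setLIntegral_const _ _).symm
      _ ≤ ∫⁻ y in B \ A, K y ∂μ := setLIntegral_mono' (hBm.diff hA) fun y hy => hK_in y hy.1
  -- (ii) the shell `B(x,2ρ) ∖ B(x,ρ)` has measure `(2^n − 1) m ≥ m`, and `K ≥ ((2r)^N)⁻¹` on it
  have hstep2 : ((2 * r) ^ N)⁻¹ * m ≤ ∫⁻ y in Bᶜ, K y ∂μ := by
    have hsub : ball x (2 * ρ) \ B ⊆ Bᶜ := fun y hy => hy.2
    have hBfin : μ B ≠ ⊤ := by rw [hball1]; exact hAtop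
    have hmeas_diff : μ (ball x (2 * ρ) \ B) = 2 ^ n * m - m := by
      rw [measure_sdiff (s₁ := ball x (2 * ρ)) (s₂ := B) (ball_subset_ball (by linarith))
          hBm.nullMeasurableSet hBfin, hball2, hball1]
    have hge : m ≤ 2 ^ n * m - m := by
      have h2n : (2 : ℝ≥0∞) * m ≤ 2 ^ n * m := by
        gcongr
        calc (2 : ℝ≥0∞) = 2 ^ 1 := (pow_one (2 : ℝ≥0∞)).symm
          _ ≤ 2 ^ n := pow_le_pow_right₀ (one_le_two : (1 : ℝ≥0∞) ≤ 2) (Nat.one_le_iff_ne_zero.2 hn.ne')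
      calc m = 2 * m - m := by rw [two_mul, ENNReal.add_sub_cancel_right hAtop]
        _ ≤ 2 ^ n * m - m := tsub_le_tsub_right h2n m
    calc ((2 * r) ^ N)⁻¹ * m ≤ ((2 * r) ^ N)⁻¹ * μ (ball x (2 * ρ) \ B) := by
          rw [hmeas_diff]; gcongr
      _ = ∫⁻ y in ball x (2 * ρ) \ B, ((2 * r) ^ N)⁻¹ ∂μ := (setLIntegral_const _ _).symm
      _ ≤ ∫⁻ y in ball x (2 * ρ) \ B, K y ∂μ :=
          setLIntegral_mono' (measurableSet_ball.diff hBm) fun y hy => hK_in2 y hy.1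
      _ ≤ ∫⁻ y in Bᶜ, K y ∂μ := lintegral_mono_set hsub
  -- (iii) the algebra `((2r)^N)⁻¹ m = 2^{−N} b^{1+t/n} m^{−t/n}`
  have hm_eq : m = r ^ (n : ℝ) * b := by rw [hrn, ENNReal.div_mul_cancel hb0 hbtop]
  have hrn_top : r ^ (n : ℝ) ≠ ⊤ := ENNReal.rpow_ne_top_of_nonneg hnpos.le hrtop
  have hm_pow : m ^ (-(t / n)) = r ^ (-t) * b ^ (-(t / n)) := by
    have hex : (n : ℝ) * -(t / n) = -t := by field_simp
    rw [hm_eq, ENNReal.mul_rpow_of_ne_top hrn_top hbtop, ← ENNReal.rpow_mul, hex]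
  have hbt0 : b ^ (t / (n : ℝ)) ≠ 0 := by
    simp [ENNReal.rpow_eq_zero_iff, hb0, hbtop]
  have hbttop : b ^ (t / (n : ℝ)) ≠ ⊤ := ENNReal.rpow_ne_top_of_nonneg (by positivity) hbtop
  have halg : ((2 * r) ^ N)⁻¹ * m = (2 : ℝ≥0∞) ^ (-N) * b ^ (1 + t / n) * m ^ (-(t / n)) := by
    have h2N : ((2 : ℝ≥0∞) * r) ^ N = 2 ^ N * r ^ N := ENNReal.mul_rpow_of_nonneg _ _ hN0.le
    calc ((2 * r) ^ N)⁻¹ * m = ((2 : ℝ≥0∞) ^ N)⁻¹ * (r ^ N)⁻¹ * (r ^ (n : ℝ) * b) := by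
          rw [h2N, ENNReal.mul_inv (Or.inr (ENNReal.rpow_ne_top_of_nonneg hN0.le hrtop))
            (Or.inl (ENNReal.rpow_ne_top_of_nonneg hN0.le ENNReal.ofNat_ne_top)), ← hm_eq]
      _ = 2 ^ (-N) * (r ^ (-N) * r ^ (n : ℝ)) * b := by
          rw [← ENNReal.rpow_neg, ← ENNReal.rpow_neg]; ring
      _ = 2 ^ (-N) * r ^ (-t) * b := by
          have hex : -N + (n : ℝ) = -t := by rw [hN]; ring
          rw [← ENNReal.rpow_add _ _ hr0 hrtop, hex]
      _ = 2 ^ (-N) * r ^ (-t) * b * (b ^ (t / (n : ℝ)) * (b ^ (t / (n : ℝ)))⁻¹) := by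
          rw [ENNReal.mul_inv_cancel hbt0 hbttop, mul_one]
      _ = 2 ^ (-N) * (b * b ^ (t / (n : ℝ))) * (r ^ (-t) * (b ^ (t / (n : ℝ)))⁻¹) := by ring
      _ = (2 : ℝ≥0∞) ^ (-N) * b ^ (1 + t / n) * m ^ (-(t / n)) := by
          rw [hm_pow, ENNReal.rpow_add _ _ hb0 hbtop, ENNReal.rpow_one, ENNReal.rpow_neg b]
  rw [← halg]
  exact hstep2.trans hstep1

end Kernel

/-! ### Dyadic level sets of a function `g : E → ℝ≥0` -/

section Shells

variable {E : Type*}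

/-- The dyadic shell of a positive value: for `0 < v` and `ℓ = clog₂ v − 1`, `2^ℓ < v ≤ 2^{ℓ+1}`, and
`2^i < v` forces `i ≤ ℓ`. [folklore] -/
private theorem dyadic_shell {v : ℝ≥0} (hv : 0 < v) :
    (2 : ℝ≥0) ^ (Int.clog 2 v - 1) < v ∧ v ≤ (2 : ℝ≥0) ^ (Int.clog 2 v - 1 + 1) ∧
      ∀ i : ℤ, (2 : ℝ≥0) ^ i < v → i ≤ Int.clog 2 v - 1 := by
  refine ⟨?_, ?_, fun i hi => ?_⟩
  · have h := Int.zpow_pred_clog_lt_self (R := ℝ≥0) (b := 2) one_lt_two hv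
    exact_mod_cast h
  · have h := Int.self_le_zpow_clog (R := ℝ≥0) (b := 2) one_lt_two v
    rw [sub_add_cancel]
    exact_mod_cast h
  · have h := (Int.zpow_lt_iff_lt_clog (R := ℝ≥0) (b := 2) one_lt_two hv).1 (by exact_mod_cast hi)
    omega

/-- The dyadic shells `{2^ℓ < g ≤ 2^{ℓ+1}}` are pairwise disjoint. [folklore] -/
private theorem pairwise_disjoint_shell (g : E → ℝ≥0) :
    Pairwise (Function.onFun Disjoint
      fun ℓ : ℤ => {x : E | (2 : ℝ≥0) ^ ℓ < g x ∧ g x ≤ (2 : ℝ≥0) ^ (ℓ + 1)}) := by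
  intro ℓ ℓ' hne
  dsimp only [Function.onFun]
  rw [Set.disjoint_left]
  intro x hx hx'
  rcases lt_or_gt_of_ne hne with h | h
  · have h1 : (2 : ℝ≥0) ^ (ℓ + 1) ≤ 2 ^ ℓ' := (zpow_le_zpow_iff_right₀ one_lt_two).2 (by omega)
    exact lt_irrefl _ ((hx.2.trans h1).trans_lt hx'.1)
  · have h1 : (2 : ℝ≥0) ^ (ℓ' + 1) ≤ 2 ^ ℓ := (zpow_le_zpow_iff_right₀ one_lt_two).2 (by omega)
    exact lt_irrefl _ ((hx'.2.trans h1).trans_lt hx.1)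

/-- The shells of index `≥ i` partition the superlevel set `{2^i < g}`. [folklore] -/
private theorem iUnion_shell_ge_eq (g : E → ℝ≥0) (i : ℤ) :
    (⋃ ℓ : ℤ, {x : E | i ≤ ℓ ∧ ((2 : ℝ≥0) ^ ℓ < g x ∧ g x ≤ (2 : ℝ≥0) ^ (ℓ + 1))}) =
      {x : E | (2 : ℝ≥0) ^ i < g x} := by
  ext x
  simp only [Set.mem_iUnion, Set.mem_setOf_eq]
  constructor
  · rintro ⟨ℓ, hiℓ, h1, -⟩
    exact ((zpow_le_zpow_iff_right₀ one_lt_two).2 hiℓ).trans_lt h1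
  · intro hx
    have hv : 0 < g x := lt_of_le_of_lt (zero_le) hx
    obtain ⟨h1, h2, h3⟩ := dyadic_shell hv
    exact ⟨Int.clog 2 (g x) - 1, h3 i hx, h1, h2⟩

/-- The shells partition `{0 < g}`. [folklore] -/
private theorem iUnion_shell_eq (g : E → ℝ≥0) :
    (⋃ ℓ : ℤ, {x : E | (2 : ℝ≥0) ^ ℓ < g x ∧ g x ≤ (2 : ℝ≥0) ^ (ℓ + 1)}) = {x : E | 0 < g x} := by
  ext x
  simp only [Set.mem_iUnion, Set.mem_setOf_eq]
  constructor
  · rintro ⟨ℓ, h1, -⟩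
    exact lt_of_le_of_lt (zero_le) h1
  · intro hv
    obtain ⟨h1, h2, -⟩ := dyadic_shell hv
    exact ⟨Int.clog 2 (g x) - 1, h1, h2⟩

/-- On the shell `{2^i < g ≤ 2^{i+1}}` and off the superlevel set `{2^{i−1} < g}` the oscillation is at
least `2^{i−1}`: `2^{i−1} ≤ |g x − g y|` (the printed `|f(x) − f(y)| ≥ 2^i − 2^{j+1} ≥ 2^{i−1}`).
[cite: DinezzaPalatucciValdinoci2012, Lemma 6.3 proof] -/
theorem two_zpow_le_edist {g : E → ℝ≥0} {i : ℤ} {x y : E} (hx : (2 : ℝ≥0) ^ i < g x)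
    (hy : ¬ (2 : ℝ≥0) ^ (i - 1) < g y) :
    (((2 : ℝ≥0) ^ (i - 1) : ℝ≥0) : ℝ≥0∞) ≤ edist (g x) (g y) := by
  rw [not_lt] at hy
  have hx' : (2 : ℝ) ^ i < (g x : ℝ) := by exact_mod_cast hx
  have hy' : (g y : ℝ) ≤ (2 : ℝ) ^ (i - 1) := by exact_mod_cast hy
  have h2 : (2 : ℝ) ^ i = 2 ^ (i - 1) * 2 := by
    rw [← zpow_add_one₀ two_ne_zero, sub_add_cancel]
  have hreal : ((2 : ℝ) ^ (i - 1)) ≤ |(g x : ℝ) - g y| := by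
    refine le_trans ?_ (le_abs_self _)
    linarith
  rw [edist_dist, NNReal.dist_eq, ← ENNReal.ofReal_coe_nnreal, NNReal.coe_zpow, NNReal.coe_ofNat]
  exact ENNReal.ofReal_le_ofReal hreal

end Shells

section Levels

variable {E : Type*} [MeasurableSpace E] {μ : Measure E}

/-- Measurability of the shells. [folklore] -/
private theorem measurableSet_shell {g : E → ℝ≥0} (hg : Measurable g) (ℓ : ℤ) :
    MeasurableSet {x : E | (2 : ℝ≥0) ^ ℓ < g x ∧ g x ≤ (2 : ℝ≥0) ^ (ℓ + 1)} := by
  have h1 : MeasurableSet {x : E | (2 : ℝ≥0) ^ ℓ < g x} := measurableSet_lt measurable_const hg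
  have h2 : MeasurableSet {x : E | g x ≤ (2 : ℝ≥0) ^ (ℓ + 1)} := measurableSet_le hg measurable_const
  exact h1.inter h2

/-- Layer-cake identity for the dyadic levels: `|{2^i < g}| = ∑_{ℓ ≥ i} |{2^ℓ < g ≤ 2^{ℓ+1}}|`
(the printed `a_k = ∑_{ℓ ≥ k} d_ℓ`, the display following `⋃_{ℓ ≥ k} D_ℓ = A_k` in the proof of Lemma 6.3).
[cite: DinezzaPalatucciValdinoci2012, Lemma 6.3 proof] -/
theorem measure_superlevel_eq_tsum {g : E → ℝ≥0} (hg : Measurable g) (i : ℤ) :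
    μ {x : E | (2 : ℝ≥0) ^ i < g x} =
      ∑' ℓ : ℤ, if i ≤ ℓ then μ {x : E | (2 : ℝ≥0) ^ ℓ < g x ∧ g x ≤ (2 : ℝ≥0) ^ (ℓ + 1)} else 0 := by
  rw [← iUnion_shell_ge_eq g i, measure_iUnion]
  · refine tsum_congr fun ℓ => ?_
    by_cases h : i ≤ ℓ
    · simp only [h, true_and, if_true]
    · simp only [h, false_and, Set.setOf_false, measure_empty, if_false]
  · intro ℓ ℓ' hne
    dsimp only [Function.onFun]
    exact Set.disjoint_of_subset (fun x hx => hx.2) (fun x hx => hx.2) (pairwise_disjoint_shell g hne)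
  · intro ℓ
    by_cases h : i ≤ ℓ
    · simpa only [h, true_and] using measurableSet_shell hg ℓ
    · simp only [h, false_and, Set.setOf_false, MeasurableSet.empty]

/-- Layer-cake upper bound `∫ g^q ≤ ∑_k 2^{(k+1)q} |{2^k < g}|`, `q > 0` (the first display of the
printed proof of Theorem 6.5). [cite: DinezzaPalatucciValdinoci2012, Theorem 6.5 proof] -/
theorem lintegral_rpow_le_tsum_superlevel {g : E → ℝ≥0} (hg : Measurable g) {q : ℝ} (hq : 0 < q) :
    ∫⁻ x, (g x : ℝ≥0∞) ^ q ∂μ ≤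
      ∑' k : ℤ, (((2 : ℝ≥0) ^ (k + 1) : ℝ≥0) : ℝ≥0∞) ^ q * μ {x : E | (2 : ℝ≥0) ^ k < g x} := by
  have hsupp : (Function.support fun x => (g x : ℝ≥0∞) ^ q) ⊆ {x : E | 0 < g x} := by
    intro x hx
    rw [Function.mem_support] at hx
    rw [Set.mem_setOf_eq, pos_iff_ne_zero]
    intro h0
    exact hx (by rw [h0, ENNReal.coe_zero, ENNReal.zero_rpow_of_pos hq])
  rw [← setLIntegral_eq_of_support_subset hsupp, ← iUnion_shell_eq g,
    lintegral_iUnion (measurableSet_shell hg) (pairwise_disjoint_shell g)]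
  refine ENNReal.tsum_le_tsum fun k => ?_
  calc ∫⁻ x in {x : E | (2 : ℝ≥0) ^ k < g x ∧ g x ≤ (2 : ℝ≥0) ^ (k + 1)}, (g x : ℝ≥0∞) ^ q ∂μ
      ≤ ∫⁻ x in {x : E | (2 : ℝ≥0) ^ k < g x ∧ g x ≤ (2 : ℝ≥0) ^ (k + 1)},
          (((2 : ℝ≥0) ^ (k + 1) : ℝ≥0) : ℝ≥0∞) ^ q ∂μ :=
        setLIntegral_mono' (measurableSet_shell hg k) fun x hx =>
          ENNReal.rpow_le_rpow (ENNReal.coe_le_coe.2 hx.2) hq.le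
    _ = (((2 : ℝ≥0) ^ (k + 1) : ℝ≥0) : ℝ≥0∞) ^ q *
          μ {x : E | (2 : ℝ≥0) ^ k < g x ∧ g x ≤ (2 : ℝ≥0) ^ (k + 1)} := setLIntegral_const _ _
    _ ≤ _ := mul_le_mul_right (measure_mono fun x hx => hx.1) _

/-- The swap-and-tail step of the proof of Lemma 6.3 / Theorem 6.5: for `T = 2^p`-type weights
(`T ≠ 0, ∞`), antitone finite levels `a_k = |{2^k < g}|` and `θ ≥ 0`,
`∑_k T^k a_{k+1} a_k^{−θ} ≤ (1 − T⁻¹)⁻¹ ∑_ℓ T^{ℓ−1} a_{ℓ−1}^{−θ} d_ℓ`, `d_ℓ = |{2^ℓ < g ≤ 2^{ℓ+1}}|`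
(uses `a_{k+1} = ∑_{ℓ ≥ k+1} d_ℓ`, Tonelli for sums, `a_k^{−θ} ≤ a_{ℓ−1}^{−θ}` for `k ≤ ℓ − 1`, and the
geometric tail `∑_{k ≤ ℓ−1} T^k = T^{ℓ−1}(1 − T⁻¹)⁻¹`; the printed computation
`∑_{i: a_{i−1} ≠ 0} ∑_{ℓ ≥ i+1} 2^{pi} a_{i−1}^{−sp/n} d_ℓ ≤ ∑_{ℓ: a_{ℓ−1} ≠ 0} ∑_{i ≤ ℓ−1} 2^{pi} a_{ℓ−1}^{−sp/n} d_ℓ`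
`≤ S` of the proof of Lemma 6.3). [cite: DinezzaPalatucciValdinoci2012, Lemma 6.3 proof] -/
theorem tsum_weight_superlevel_le {T : ℝ≥0∞} (hT0 : T ≠ 0) (hTtop : T ≠ ⊤) {θ : ℝ} (hθ : 0 ≤ θ)
    {g : E → ℝ≥0} (hg : Measurable g) :
    ∑' k : ℤ, T ^ (k : ℝ) * (μ {x : E | (2 : ℝ≥0) ^ (k + 1) < g x} *
        μ {x : E | (2 : ℝ≥0) ^ k < g x} ^ (-θ)) ≤
      (1 - T⁻¹)⁻¹ * ∑' ℓ : ℤ, T ^ (((ℓ - 1 : ℤ)) : ℝ) *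
        (μ {x : E | (2 : ℝ≥0) ^ (ℓ - 1) < g x} ^ (-θ) *
          μ {x : E | (2 : ℝ≥0) ^ ℓ < g x ∧ g x ≤ (2 : ℝ≥0) ^ (ℓ + 1)}) := by
  -- notation
  set a : ℤ → ℝ≥0∞ := fun k => μ {x : E | (2 : ℝ≥0) ^ k < g x} with ha
  set d : ℤ → ℝ≥0∞ := fun ℓ => μ {x : E | (2 : ℝ≥0) ^ ℓ < g x ∧ g x ≤ (2 : ℝ≥0) ^ (ℓ + 1)} with hd
  have hanti : ∀ {k k' : ℤ}, k ≤ k' → a k' ≤ a k := by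
    intro k k' hkk'
    simp only [ha]
    refine measure_mono fun x (hx : (2 : ℝ≥0) ^ k' < g x) => ?_
    exact lt_of_le_of_lt ((zpow_le_zpow_iff_right₀ one_lt_two).2 hkk') hx
  -- expand `a (k+1)` and swap the sums
  have hexp : ∀ k : ℤ, T ^ (k : ℝ) * (a (k + 1) * a k ^ (-θ)) =
      ∑' ℓ : ℤ, if k + 1 ≤ ℓ then T ^ (k : ℝ) * a k ^ (-θ) * d ℓ else 0 := by
    intro k
    have hk : a (k + 1) = ∑' ℓ : ℤ, if k + 1 ≤ ℓ then d ℓ else 0 := by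
      simp only [ha, hd]; exact measure_superlevel_eq_tsum hg (k + 1)
    rw [hk, mul_comm _ (a k ^ (-θ)), ← mul_assoc, ← ENNReal.tsum_mul_left]
    refine tsum_congr fun ℓ => ?_
    split_ifs <;> simp
  change ∑' k : ℤ, T ^ (k : ℝ) * (a (k + 1) * a k ^ (-θ)) ≤
    (1 - T⁻¹)⁻¹ * ∑' ℓ : ℤ, T ^ (((ℓ - 1 : ℤ)) : ℝ) * (a (ℓ - 1) ^ (-θ) * d ℓ)
  simp_rw [hexp]
  rw [ENNReal.tsum_comm, ← ENNReal.tsum_mul_left]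
  refine ENNReal.tsum_le_tsum fun ℓ => ?_
  -- for fixed `ℓ`: `∑_k [k+1 ≤ ℓ] T^k a_k^{-θ} d_ℓ ≤ a_{ℓ-1}^{-θ} d_ℓ ∑_{k ≤ ℓ-1} T^k`
  calc ∑' k : ℤ, (if k + 1 ≤ ℓ then T ^ (k : ℝ) * a k ^ (-θ) * d ℓ else 0)
      ≤ ∑' k : ℤ, (if k ≤ ℓ - 1 then T ^ (k : ℝ) else 0) * (a (ℓ - 1) ^ (-θ) * d ℓ) := by
        refine ENNReal.tsum_le_tsum fun k => ?_
        by_cases hk : k + 1 ≤ ℓ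
        · have hk' : k ≤ ℓ - 1 := by omega
          rw [if_pos hk, if_pos hk', mul_assoc]
          exact mul_le_mul_right (mul_le_mul_left (rpow_neg_le_rpow_neg_of_le (hanti hk') hθ) _) _
        · have hk' : ¬ k ≤ ℓ - 1 := by omega
          rw [if_neg hk, if_neg hk', zero_mul]
    _ = T ^ (((ℓ - 1 : ℤ)) : ℝ) * (1 - T⁻¹)⁻¹ * (a (ℓ - 1) ^ (-θ) * d ℓ) := by
        rw [ENNReal.tsum_mul_right, tsum_ite_le_rpow_eq hT0 hTtop (ℓ - 1)]
    _ = (1 - T⁻¹)⁻¹ * (T ^ (((ℓ - 1 : ℤ)) : ℝ) * (a (ℓ - 1) ^ (-θ) * d ℓ)) := by ring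

end Levels

/-! ### Lemma 6.3 and Theorem 6.5 -/

section Main

variable {E : Type*} [NormedAddCommGroup E] [NormedSpace ℝ E] [FiniteDimensional ℝ E]
  [MeasurableSpace E] [BorelSpace E] (μ : Measure E) [μ.IsAddHaarMeasure]

/-- The per-level estimate of the proof of **Lemma 6.3**: with `A_{i−1} = {2^{i−1} < g}`,
`D_i = {2^i < g ≤ 2^{i+1}}` and the constant `c` of `lemma_6_1` (`t > 0`, printed `t = sp`),
`c · (2^{i−1})^p · |A_{i−1}|^{−t/n} · |D_i| ≤ ∫_{D_i} ∫_{ℝⁿ} |g x − g y|^p / |x−y|^{n+t} dy dx`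
(the printed `∑_{j ≤ i−2} ∫_{D_i×D_j} |f(x)−f(y)|^p/|x−y|^{n+sp} dx dy ≥ c_o 2^{pi} a_{i−1}^{−sp/n} d_i`,
obtained from «This and Lemma 6.1 imply that, for any `i ∈ ℤ` and any `x ∈ D_i` …»; here the inner
integral runs over all of `ℝⁿ`, which only enlarges the right-hand side).
[cite: DinezzaPalatucciValdinoci2012, Lemma 6.3 proof] -/
theorem level_estimate (hn : 0 < Module.finrank ℝ E) {t p : ℝ} (ht : 0 < t) (hp : 0 < p)
    {g : E → ℝ≥0} (hg : Measurable g) (i : ℤ)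
    (htop : μ {x : E | (2 : ℝ≥0) ^ (i - 1) < g x} ≠ ⊤) :
    (2 : ℝ≥0∞) ^ (-((Module.finrank ℝ E : ℝ) + t)) *
        μ (ball (0 : E) 1) ^ (1 + t / (Module.finrank ℝ E : ℝ)) *
        ((((2 : ℝ≥0) ^ (i - 1) : ℝ≥0) : ℝ≥0∞) ^ p *
          (μ {x : E | (2 : ℝ≥0) ^ (i - 1) < g x} ^ (-(t / (Module.finrank ℝ E : ℝ))) *
            μ {x : E | (2 : ℝ≥0) ^ i < g x ∧ g x ≤ (2 : ℝ≥0) ^ (i + 1)})) ≤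
      ∫⁻ x in {x : E | (2 : ℝ≥0) ^ i < g x ∧ g x ≤ (2 : ℝ≥0) ^ (i + 1)},
        ∫⁻ y, edist (g x) (g y) ^ p * (edist x y ^ ((Module.finrank ℝ E : ℝ) + t))⁻¹ ∂μ ∂μ := by
  set n : ℕ := Module.finrank ℝ E with hn_def
  set C₁ : ℝ≥0∞ := (2 : ℝ≥0∞) ^ (-((n : ℝ) + t)) * μ (ball (0 : E) 1) ^ (1 + t / (n : ℝ)) with hC₁
  set A : Set E := {x : E | (2 : ℝ≥0) ^ (i - 1) < g x} with hA
  set D : Set E := {x : E | (2 : ℝ≥0) ^ i < g x ∧ g x ≤ (2 : ℝ≥0) ^ (i + 1)} with hD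
  set W : ℝ≥0∞ := (((2 : ℝ≥0) ^ (i - 1) : ℝ≥0) : ℝ≥0∞) ^ p with hW
  have hAm : MeasurableSet A := measurableSet_lt measurable_const hg
  have hDm : MeasurableSet D := measurableSet_shell hg i
  have hDA : D ⊆ A := by
    intro x hx
    have h1 : (2 : ℝ≥0) ^ (i - 1) ≤ 2 ^ i := (zpow_le_zpow_iff_right₀ one_lt_two).2 (by omega)
    exact h1.trans_lt hx.1
  by_cases h0 : μ A = 0
  · have hD0 : μ D = 0 := measure_mono_null hDA h0
    simp only [hD0, mul_zero, zero_le]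
  -- pointwise lower bound of the inner integral on `D`
  have hpt : ∀ x ∈ D, W * (C₁ * μ A ^ (-(t / (n : ℝ)))) ≤
      ∫⁻ y, edist (g x) (g y) ^ p * (edist x y ^ ((n : ℝ) + t))⁻¹ ∂μ := by
    intro x hx
    have h61 := lemma_6_1 μ hn ht hAm h0 htop x
    calc W * (C₁ * μ A ^ (-(t / (n : ℝ))))
        ≤ W * ∫⁻ y in Aᶜ, (edist x y ^ ((n : ℝ) + t))⁻¹ ∂μ := mul_le_mul_right h61 W
      _ = ∫⁻ y in Aᶜ, W * (edist x y ^ ((n : ℝ) + t))⁻¹ ∂μ :=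
          (lintegral_const_mul W (measurable_kernel _ x)).symm
      _ ≤ ∫⁻ y in Aᶜ, edist (g x) (g y) ^ p * (edist x y ^ ((n : ℝ) + t))⁻¹ ∂μ := by
          refine setLIntegral_mono' hAm.compl fun y hy => ?_
          gcongr
          exact ENNReal.rpow_le_rpow (two_zpow_le_edist hx.1 hy) hp.le
      _ ≤ _ := setLIntegral_le_lintegral _ _
  calc C₁ * (W * (μ A ^ (-(t / (n : ℝ))) * μ D)) = ∫⁻ _ in D, W * (C₁ * μ A ^ (-(t / (n : ℝ)))) ∂μ := by
        rw [setLIntegral_const]; ring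
    _ ≤ _ := setLIntegral_mono' hDm hpt

/-- **Lemma 6.3** of Di Nezza–Palatucci–Valdinoci in the additive form used here: with `T = 2^p`,
`a_k = |{2^k < g}|` (all finite) and `θ = t/n`,
`∑_ℓ T^{ℓ−1} a_{ℓ−1}^{−θ} |{2^ℓ < g ≤ 2^{ℓ+1}}| ≤ c⁻¹ [g]^p` where `c` is the constant of `lemma_6_1` and
`[g]^p = ∫∫ |g x − g y|^p / |x−y|^{n+t}`; the printed statement `∑_{a_k ≠ 0} 2^{pk} a_{k+1} a_k^{−sp/n} ≤ C [g]^p`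
follows by `a_{k+1} = ∑_{ℓ ≥ k+1} d_ℓ` and the geometric tail (`tsum_weight_superlevel_le`).
[cite: DinezzaPalatucciValdinoci2012, Lemma 6.3] -/
theorem tsum_level_le_gagliardo (hn : 0 < Module.finrank ℝ E) {t p : ℝ} (ht : 0 < t) (hp : 0 < p)
    {g : E → ℝ≥0} (hg : Measurable g) (htop : ∀ k : ℤ, μ {x : E | (2 : ℝ≥0) ^ k < g x} ≠ ⊤) :
    (2 : ℝ≥0∞) ^ (-((Module.finrank ℝ E : ℝ) + t)) *
        μ (ball (0 : E) 1) ^ (1 + t / (Module.finrank ℝ E : ℝ)) *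
      ∑' ℓ : ℤ, ((2 : ℝ≥0∞) ^ p) ^ (((ℓ - 1 : ℤ)) : ℝ) *
        (μ {x : E | (2 : ℝ≥0) ^ (ℓ - 1) < g x} ^ (-(t / (Module.finrank ℝ E : ℝ))) *
          μ {x : E | (2 : ℝ≥0) ^ ℓ < g x ∧ g x ≤ (2 : ℝ≥0) ^ (ℓ + 1)}) ≤
      ∫⁻ x, ∫⁻ y, edist (g x) (g y) ^ p * (edist x y ^ ((Module.finrank ℝ E : ℝ) + t))⁻¹ ∂μ ∂μ := by
  rw [← ENNReal.tsum_mul_left]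
  calc ∑' ℓ : ℤ, (2 : ℝ≥0∞) ^ (-((Module.finrank ℝ E : ℝ) + t)) *
          μ (ball (0 : E) 1) ^ (1 + t / (Module.finrank ℝ E : ℝ)) *
          (((2 : ℝ≥0∞) ^ p) ^ (((ℓ - 1 : ℤ)) : ℝ) *
            (μ {x : E | (2 : ℝ≥0) ^ (ℓ - 1) < g x} ^ (-(t / (Module.finrank ℝ E : ℝ))) *
              μ {x : E | (2 : ℝ≥0) ^ ℓ < g x ∧ g x ≤ (2 : ℝ≥0) ^ (ℓ + 1)}))
      ≤ ∑' ℓ : ℤ, ∫⁻ x in {x : E | (2 : ℝ≥0) ^ ℓ < g x ∧ g x ≤ (2 : ℝ≥0) ^ (ℓ + 1)},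
          ∫⁻ y, edist (g x) (g y) ^ p * (edist x y ^ ((Module.finrank ℝ E : ℝ) + t))⁻¹ ∂μ ∂μ := by
        refine ENNReal.tsum_le_tsum fun ℓ => ?_
        rw [← coe_two_zpow_rpow (ℓ - 1) p]
        exact level_estimate μ hn ht hp hg ℓ (htop _)
    _ = ∫⁻ x in ⋃ ℓ : ℤ, {x : E | (2 : ℝ≥0) ^ ℓ < g x ∧ g x ≤ (2 : ℝ≥0) ^ (ℓ + 1)},
          ∫⁻ y, edist (g x) (g y) ^ p * (edist x y ^ ((Module.finrank ℝ E : ℝ) + t))⁻¹ ∂μ ∂μ :=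
        (lintegral_iUnion (measurableSet_shell hg) (pairwise_disjoint_shell g) _).symm
    _ ≤ _ := setLIntegral_le_lintegral _ _

/-- **Theorem 6.5 for bounded non-negative functions with support of finite measure** (the case treated
in the body of the printed proof): for `0 < s < 1`, `0 < p`, `sp < n` there is `C = C(μ,s,p) < ∞` such that
for every measurable `g : E → [0, 2^{N₀}]` with `μ(support g) < ∞`,
`(∫ g^{p⋆})^{(n−sp)/n} ≤ C ∫∫ |g x − g y|^p / |x−y|^{n+sp}`, `p⋆ = np/(n−sp)`.
[cite: DinezzaPalatucciValdinoci2012, Theorem 6.5 proof] -/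
theorem exists_lintegral_rpow_le_mul_gagliardo_of_bounded (hn : 0 < Module.finrank ℝ E) {s p : ℝ}
    (hs : 0 < s) (hp : 0 < p) (hsp : s * p < Module.finrank ℝ E) :
    ∃ C : ℝ≥0∞, C ≠ ⊤ ∧ ∀ (g : E → ℝ≥0), Measurable g → μ (Function.support g) ≠ ⊤ →
      (∃ N₀ : ℤ, ∀ x, g x ≤ (2 : ℝ≥0) ^ N₀) →
      (∫⁻ x, (g x : ℝ≥0∞) ^ ((Module.finrank ℝ E : ℝ) * p / ((Module.finrank ℝ E : ℝ) - s * p)) ∂μ) ^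
          (((Module.finrank ℝ E : ℝ) - s * p) / (Module.finrank ℝ E : ℝ)) ≤
        C * ∫⁻ x, ∫⁻ y, edist (g x) (g y) ^ p *
          (edist x y ^ ((Module.finrank ℝ E : ℝ) + s * p))⁻¹ ∂μ ∂μ := by
  set n : ℕ := Module.finrank ℝ E with hn_def
  have hnpos : (0 : ℝ) < n := by exact_mod_cast hn
  have hn0 : (n : ℝ) ≠ 0 := hnpos.ne'
  set θ : ℝ := s * p / n with hθ
  have hθ0 : 0 < θ := by positivity
  have hθ1 : θ < 1 := by rw [hθ, div_lt_one hnpos]; exact hsp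
  have h1θ : 0 < 1 - θ := sub_pos.2 hθ1
  have hnsp : 0 < (n : ℝ) - s * p := sub_pos.2 hsp
  set q : ℝ := (n : ℝ) * p / ((n : ℝ) - s * p) with hq
  have hq0 : 0 < q := by positivity
  have hexp1 : ((n : ℝ) - s * p) / (n : ℝ) = 1 - θ := by
    rw [hθ, sub_div, div_self hn0]
  have hnsp' : (n : ℝ) - s * p ≠ 0 := hnsp.ne'
  have hexp2 : q * (1 - θ) = p := by
    rw [← hexp1, hq, div_mul_div_comm, mul_comm ((n : ℝ) - s * p) (n : ℝ), mul_div_mul_right _ _ hnsp',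
      mul_div_cancel_left₀ _ hn0]
  set T : ℝ≥0∞ := (2 : ℝ≥0∞) ^ p with hT
  have hT0 : T ≠ 0 := by simp [hT, ENNReal.rpow_eq_zero_iff]
  have hTtop : T ≠ ⊤ := by simp [hT, ENNReal.rpow_eq_top_iff]
  have hT1 : 1 < T := ENNReal.one_lt_rpow ENNReal.one_lt_two hp
  have hTinv : (1 - T⁻¹)⁻¹ ≠ ⊤ := by
    refine ENNReal.inv_ne_top.2 (tsub_pos_iff_lt.2 ?_).ne'
    exact ENNReal.inv_lt_one.2 hT1
  set b : ℝ≥0∞ := μ (ball (0 : E) 1) with hb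
  have hb0 : b ≠ 0 := (measure_ball_pos μ (0 : E) one_pos).ne'
  have hbtop : b ≠ ⊤ := by
    haveI : Nontrivial E := Module.nontrivial_of_finrank_pos hn
    exact measure_ball_lt_top.ne
  set C₁ : ℝ≥0∞ := (2 : ℝ≥0∞) ^ (-((n : ℝ) + s * p)) * b ^ (1 + s * p / (n : ℝ)) with hC₁
  have hC₁0 : C₁ ≠ 0 := by
    simp [hC₁, ENNReal.rpow_eq_zero_iff, hb0, hbtop]
  have hC₁top : C₁ ≠ ⊤ := by
    refine ENNReal.mul_ne_top ?_ (ENNReal.rpow_ne_top_of_nonneg (by positivity) hbtop)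
    simp [ENNReal.rpow_eq_top_iff]
  -- the constant
  refine ⟨T * T ^ (1 / (1 - θ)) * ((1 - T⁻¹)⁻¹ * C₁⁻¹), ?_, fun g hg hsupp hbdd => ?_⟩
  · exact ENNReal.mul_ne_top (ENNReal.mul_ne_top hTtop (ENNReal.rpow_ne_top_of_nonneg (by positivity) hTtop))
      (ENNReal.mul_ne_top hTinv (ENNReal.inv_ne_top.2 hC₁0))
  obtain ⟨N₀, hN₀⟩ := hbdd
  -- the levels
  set a : ℤ → ℝ≥0∞ := fun k => μ {x : E | (2 : ℝ≥0) ^ k < g x} with ha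
  set d : ℤ → ℝ≥0∞ := fun ℓ => μ {x : E | (2 : ℝ≥0) ^ ℓ < g x ∧ g x ≤ (2 : ℝ≥0) ^ (ℓ + 1)} with hd
  have hanti : Antitone a := by
    intro k k' hkk'
    simp only [ha]
    refine measure_mono fun x (hx : (2 : ℝ≥0) ^ k' < g x) => ?_
    exact lt_of_le_of_lt ((zpow_le_zpow_iff_right₀ one_lt_two).2 hkk') hx
  have ha_le : ∀ k, a k ≤ μ (Function.support g) := by
    intro k
    refine measure_mono fun x hx => ?_
    rw [Function.mem_support]
    exact (lt_of_le_of_lt (zero_le) hx).ne'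
  have hatop : ∀ k, a k ≠ ⊤ := fun k => ((ha_le k).trans_lt hsupp.lt_top).ne
  have ha_zero : ∀ k, N₀ ≤ k → a k = 0 := by
    intro k hk
    simp only [ha]
    convert measure_empty (μ := μ)
    ext x
    simp only [Set.mem_setOf_eq, Set.mem_empty_iff_false, iff_false, not_lt]
    exact (hN₀ x).trans ((zpow_le_zpow_iff_right₀ one_lt_two).2 hk)
  set Gag : ℝ≥0∞ := ∫⁻ x, ∫⁻ y, edist (g x) (g y) ^ p *
    (edist x y ^ ((n : ℝ) + s * p))⁻¹ ∂μ ∂μ with hGag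
  set L : ℝ≥0∞ := ∑' k : ℤ, T ^ (k : ℝ) * a k ^ (1 - θ) with hL
  -- Step 1 (layer cake): `(∫ g^q)^{1-θ} ≤ T L`
  have hstep1 : (∫⁻ x, (g x : ℝ≥0∞) ^ q ∂μ) ^ (1 - θ) ≤ T * L := by
    calc (∫⁻ x, (g x : ℝ≥0∞) ^ q ∂μ) ^ (1 - θ)
        ≤ (∑' k : ℤ, (((2 : ℝ≥0) ^ (k + 1) : ℝ≥0) : ℝ≥0∞) ^ q * a k) ^ (1 - θ) :=
          ENNReal.rpow_le_rpow (lintegral_rpow_le_tsum_superlevel hg hq0) h1θ.le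
      _ ≤ ∑' k : ℤ, ((((2 : ℝ≥0) ^ (k + 1) : ℝ≥0) : ℝ≥0∞) ^ q * a k) ^ (1 - θ) :=
          rpow_tsum_le_tsum_rpow _ h1θ (by linarith)
      _ = ∑' k : ℤ, T * (T ^ (k : ℝ) * a k ^ (1 - θ)) := by
          refine tsum_congr fun k => ?_
          rw [ENNReal.mul_rpow_of_nonneg _ _ h1θ.le, ← ENNReal.rpow_mul, hexp2, coe_two_zpow_rpow, ← hT,
            Int.cast_add, Int.cast_one, ENNReal.rpow_add _ _ hT0 hTtop, ENNReal.rpow_one]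
          ring
      _ = T * L := by rw [ENNReal.tsum_mul_left]
  -- Step 2: `L < ∞` (bounded `g`, support of finite measure)
  have hLtop : L ≠ ⊤ := by
    have hle : L ≤ (∑' k : ℤ, if k ≤ N₀ - 1 then T ^ (k : ℝ) else 0) * μ (Function.support g) ^ (1 - θ) := by
      rw [hL, ← ENNReal.tsum_mul_right]
      refine ENNReal.tsum_le_tsum fun k => ?_
      by_cases hk : k ≤ N₀ - 1
      · rw [if_pos hk]; exact mul_le_mul_right (ENNReal.rpow_le_rpow (ha_le k) h1θ.le) _
      · rw [if_neg hk, ha_zero k (by omega), ENNReal.zero_rpow_of_pos h1θ, mul_zero, zero_mul]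
    refine (hle.trans_lt ?_).ne
    rw [tsum_ite_le_rpow_eq hT0 hTtop]
    refine ENNReal.mul_lt_top (ENNReal.mul_lt_top ?_ hTinv.lt_top) ?_
    · exact (ENNReal.rpow_ne_top_of_nonneg' (pos_iff_ne_zero.2 hT0) hTtop).lt_top
    · exact (ENNReal.rpow_ne_top_of_nonneg h1θ.le hsupp).lt_top
  -- Step 3 (Lemma 6.2): `L ≤ T^{1/(1-θ)} R₀`
  have hstep3 := lemma_6_2 hθ0 hθ1 hT0 hTtop hanti hatop hLtop
  -- Step 4 (Lemma 6.3): `R₀ ≤ (1 − T⁻¹)⁻¹ C₁⁻¹ Gag`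
  have h63 : C₁ * ∑' ℓ : ℤ, T ^ (((ℓ - 1 : ℤ)) : ℝ) * (a (ℓ - 1) ^ (-θ) * d ℓ) ≤ Gag :=
    tsum_level_le_gagliardo μ hn (mul_pos hs hp) hp hg hatop
  have h63' : ∑' ℓ : ℤ, T ^ (((ℓ - 1 : ℤ)) : ℝ) * (a (ℓ - 1) ^ (-θ) * d ℓ) ≤ C₁⁻¹ * Gag := by
    calc ∑' ℓ : ℤ, T ^ (((ℓ - 1 : ℤ)) : ℝ) * (a (ℓ - 1) ^ (-θ) * d ℓ)
        = C₁⁻¹ * (C₁ * ∑' ℓ : ℤ, T ^ (((ℓ - 1 : ℤ)) : ℝ) * (a (ℓ - 1) ^ (-θ) * d ℓ)) := by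
          rw [← mul_assoc, ENNReal.inv_mul_cancel hC₁0 hC₁top, one_mul]
      _ ≤ C₁⁻¹ * Gag := mul_le_mul_right h63 _
  have hstep4 : ∑' k : ℤ, T ^ (k : ℝ) * (a (k + 1) * a k ^ (-θ)) ≤ (1 - T⁻¹)⁻¹ * (C₁⁻¹ * Gag) :=
    (tsum_weight_superlevel_le hT0 hTtop hθ0.le hg).trans (mul_le_mul_right h63' _)
  -- assembly
  rw [hexp1]
  calc (∫⁻ x, (g x : ℝ≥0∞) ^ q ∂μ) ^ (1 - θ) ≤ T * L := hstep1
    _ ≤ T * (T ^ (1 / (1 - θ)) * ((1 - T⁻¹)⁻¹ * (C₁⁻¹ * Gag))) :=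
        mul_le_mul_right (hstep3.trans (mul_le_mul_right hstep4 _)) _
    _ = T * T ^ (1 / (1 - θ)) * ((1 - T⁻¹)⁻¹ * C₁⁻¹) * Gag := by ring

/-- Truncation at a level is `1`-Lipschitz: `|min(a,c) − min(b,c)| ≤ |a − b|`. [folklore] -/
private theorem edist_min_min_le (a b c : ℝ≥0) : edist (min a c) (min b c) ≤ edist a b := by
  rw [edist_dist, edist_dist]
  refine ENNReal.ofReal_le_ofReal ?_
  rw [NNReal.dist_eq, NNReal.dist_eq, NNReal.coe_min, NNReal.coe_min]
  exact (abs_min_sub_min_le_max _ _ _ _).trans_eq (by rw [sub_self, abs_zero, max_eq_left (abs_nonneg _)])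

/-- **Theorem 6.5 for non-negative functions with support of finite measure**: the boundedness
hypothesis of `exists_lintegral_rpow_le_mul_gagliardo_of_bounded` is removed by the truncations
`g_N = min(g, 2^N)` and monotone convergence (the printed Lemma 6.4 / dominated-convergence step;
truncation is `1`-Lipschitz, so the Gagliardo energy of `g_N` is at most that of `g` termwise).
[cite: DinezzaPalatucciValdinoci2012, Theorem 6.5 proof, Lemma 6.4] -/
theorem exists_lintegral_rpow_le_mul_gagliardo_nnreal (hn : 0 < Module.finrank ℝ E) {s p : ℝ}
    (hs : 0 < s) (hp : 0 < p) (hsp : s * p < Module.finrank ℝ E) :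
    ∃ C : ℝ≥0∞, C ≠ ⊤ ∧ ∀ (g : E → ℝ≥0), Measurable g → μ (Function.support g) ≠ ⊤ →
      (∫⁻ x, (g x : ℝ≥0∞) ^ ((Module.finrank ℝ E : ℝ) * p / ((Module.finrank ℝ E : ℝ) - s * p)) ∂μ) ^
          (((Module.finrank ℝ E : ℝ) - s * p) / (Module.finrank ℝ E : ℝ)) ≤
        C * ∫⁻ x, ∫⁻ y, edist (g x) (g y) ^ p *
          (edist x y ^ ((Module.finrank ℝ E : ℝ) + s * p))⁻¹ ∂μ ∂μ := by
  obtain ⟨C, hC, hmain⟩ := exists_lintegral_rpow_le_mul_gagliardo_of_bounded μ hn hs hp hsp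
  refine ⟨C, hC, fun g hg hsupp => ?_⟩
  set n : ℕ := Module.finrank ℝ E with hn_def
  have hnpos : (0 : ℝ) < n := by exact_mod_cast hn
  have hnsp : 0 < (n : ℝ) - s * p := sub_pos.2 hsp
  set q : ℝ := (n : ℝ) * p / ((n : ℝ) - s * p) with hq
  have hq0 : 0 < q := by positivity
  set γ : ℝ := ((n : ℝ) - s * p) / (n : ℝ) with hγ
  have hγ0 : 0 < γ := by positivity
  set Gag : ℝ≥0∞ := ∫⁻ x, ∫⁻ y, edist (g x) (g y) ^ p *
    (edist x y ^ ((n : ℝ) + s * p))⁻¹ ∂μ ∂μ with hGag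
  -- the truncations `g_N = min (g, 2^N)`
  set gN : ℕ → E → ℝ≥0 := fun N x => min (g x) ((2 : ℝ≥0) ^ (N : ℤ)) with hgN
  have hgN_meas : ∀ N, Measurable (gN N) := fun N => hg.min measurable_const
  have hgN_supp : ∀ N, μ (Function.support (gN N)) ≠ ⊤ := by
    intro N
    refine ((measure_mono ?_).trans_lt hsupp.lt_top).ne
    intro x hx
    rw [Function.mem_support] at hx ⊢
    intro h0
    exact hx (by simp [hgN, h0])
  have hgN_bdd : ∀ N, ∃ N₀ : ℤ, ∀ x, gN N x ≤ (2 : ℝ≥0) ^ N₀ :=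
    fun N => ⟨N, fun x => min_le_right _ _⟩
  have hGagN : ∀ N, ∫⁻ x, ∫⁻ y, edist (gN N x) (gN N y) ^ p *
      (edist x y ^ ((n : ℝ) + s * p))⁻¹ ∂μ ∂μ ≤ Gag := by
    intro N
    refine lintegral_mono fun x => lintegral_mono fun y => ?_
    exact mul_le_mul_left (ENNReal.rpow_le_rpow (edist_min_min_le _ _ _) hp.le) _
  -- the bound for each truncation
  have hN : ∀ N, ∫⁻ x, (gN N x : ℝ≥0∞) ^ q ∂μ ≤ (C * Gag) ^ (1 / γ) := by
    intro N
    have h := (hmain (gN N) (hgN_meas N) (hgN_supp N) (hgN_bdd N)).trans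
      (mul_le_mul_right (hGagN N) C)
    calc ∫⁻ x, (gN N x : ℝ≥0∞) ^ q ∂μ = ((∫⁻ x, (gN N x : ℝ≥0∞) ^ q ∂μ) ^ γ) ^ (1 / γ) := by
          rw [← ENNReal.rpow_mul, mul_one_div_cancel hγ0.ne', ENNReal.rpow_one]
      _ ≤ (C * Gag) ^ (1 / γ) := ENNReal.rpow_le_rpow h (by positivity)
  -- monotone convergence
  have hmono : Monotone fun N x => (gN N x : ℝ≥0∞) ^ q := by
    intro N M hNM x
    refine ENNReal.rpow_le_rpow (ENNReal.coe_le_coe.2 (min_le_min_left _ ?_)) hq0.le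
    exact zpow_le_zpow_right₀ one_le_two (by exact_mod_cast hNM)
  have hsup : ∀ x, ⨆ N, (gN N x : ℝ≥0∞) ^ q = (g x : ℝ≥0∞) ^ q := by
    intro x
    apply le_antisymm
    · exact iSup_le fun N => ENNReal.rpow_le_rpow (ENNReal.coe_le_coe.2 (min_le_left _ _)) hq0.le
    · obtain ⟨N, hNx⟩ := pow_unbounded_of_one_lt (g x) (one_lt_two : (1 : ℝ≥0) < 2)
      refine le_iSup_of_le N (le_of_eq ?_)
      have hmin : gN N x = g x := by
        simp only [hgN]
        rw [min_eq_left]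
        rw [zpow_natCast]
        exact hNx.le
      rw [hmin]
  have hlim : ∫⁻ x, (g x : ℝ≥0∞) ^ q ∂μ = ⨆ N, ∫⁻ x, (gN N x : ℝ≥0∞) ^ q ∂μ := by
    rw [← lintegral_iSup (fun N => (hgN_meas N).coe_nnreal_ennreal.pow_const q) hmono]
    exact lintegral_congr fun x => (hsup x).symm
  calc (∫⁻ x, (g x : ℝ≥0∞) ^ q ∂μ) ^ γ = (⨆ N, ∫⁻ x, (gN N x : ℝ≥0∞) ^ q ∂μ) ^ γ := by rw [hlim]
    _ ≤ ((C * Gag) ^ (1 / γ)) ^ γ := ENNReal.rpow_le_rpow (iSup_le hN) hγ0.le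
    _ = C * Gag := by rw [← ENNReal.rpow_mul, one_div_mul_cancel hγ0.ne', ENNReal.rpow_one]

variable {F : Type*} [NormedAddCommGroup F]

/-- **Theorem 6.5 of Di Nezza–Palatucci–Valdinoci (fractional Gagliardo–Sobolev inequality).**
`0 < s < 1`, `1 ≤ p`, `sp < n = dim E ≥ 1`, `p⋆ = np/(n − sp)`: there is `C < ∞` (depending on
`μ, s, p` only) such that for every a.e.-strongly measurable `f : E → F` whose support has finite
measure,
`(∫ ‖f‖^{p⋆} dμ)^{(n−sp)/n} ≤ C ∫∫ ‖f(x) − f(y)‖^p / ‖x − y‖^{n+sp} dμ(y) dμ(x)`,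
i.e. `‖f‖_{L^{p⋆}}^p ≤ C [f]^p_{W^{s,p}}` (recall `p/p⋆ = (n − sp)/n`).  Printed for `ℝⁿ` with Lebesgue
measure, real-valued measurable `f` with compact support; the reduction to `‖f‖ ≥ 0` is the first line
of the printed proof of Lemma 6.3 (`| ‖f x‖ − ‖f y‖ | ≤ ‖f x − f y‖`).
[cite: DinezzaPalatucciValdinoci2012, Theorem 6.5] -/
theorem exists_lintegral_rpow_enorm_le_mul_gagliardo (hn : 0 < Module.finrank ℝ E) {s p : ℝ}
    (hs0 : 0 < s) (_hs1 : s < 1) (hp : 1 ≤ p) (hsp : s * p < Module.finrank ℝ E) :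
    ∃ C : ℝ≥0∞, C ≠ ⊤ ∧ ∀ (f : E → F), AEStronglyMeasurable f μ → μ (Function.support f) ≠ ⊤ →
      (∫⁻ x, ‖f x‖ₑ ^ ((Module.finrank ℝ E : ℝ) * p / ((Module.finrank ℝ E : ℝ) - s * p)) ∂μ) ^
          (((Module.finrank ℝ E : ℝ) - s * p) / (Module.finrank ℝ E : ℝ)) ≤
        C * ∫⁻ x, ∫⁻ y, ‖f x - f y‖ₑ ^ p / ‖x - y‖ₑ ^ ((Module.finrank ℝ E : ℝ) + s * p) ∂μ ∂μ := by
  have hp0 : 0 < p := by linarith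
  obtain ⟨C, hC, hmain⟩ := exists_lintegral_rpow_le_mul_gagliardo_nnreal μ hn hs0 hp0 hsp
  refine ⟨C, hC, fun f hf hsupp => ?_⟩
  set n : ℕ := Module.finrank ℝ E with hn_def
  set q : ℝ := (n : ℝ) * p / ((n : ℝ) - s * p) with hq
  set γ : ℝ := ((n : ℝ) - s * p) / (n : ℝ) with hγ
  -- a measurable version `g` of `‖f‖`
  have hg₀ : AEMeasurable (fun x => ‖f x‖₊) μ := hf.nnnorm.aemeasurable
  set g : E → ℝ≥0 := hg₀.mk _ with hg
  have hgm : Measurable g := hg₀.measurable_mk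
  have hae : (fun x => ‖f x‖₊) =ᵐ[μ] g := hg₀.ae_eq_mk
  have hnull : μ {x | ¬((fun x => ‖f x‖₊) x = g x)} = 0 := ae_iff.1 hae
  have hgsupp : μ (Function.support g) ≠ ⊤ := by
    have hsub : Function.support g ⊆
        Function.support f ∪ {x | ¬((fun x => ‖f x‖₊) x = g x)} := by
      intro x hx
      rw [Function.mem_support] at hx
      by_cases h : ‖f x‖₊ = g x
      · left
        rw [Function.mem_support, ← nnnorm_ne_zero_iff, h]
        exact hx
      · right; exact h
    refine ((measure_mono hsub).trans_lt ((measure_union_le _ _).trans_lt ?_)).ne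
    rw [hnull, add_zero]
    exact hsupp.lt_top
  have h1 : ∫⁻ x, ‖f x‖ₑ ^ q ∂μ = ∫⁻ x, (g x : ℝ≥0∞) ^ q ∂μ := by
    refine lintegral_congr_ae (hae.mono fun x hx => ?_)
    simp only at hx
    show ‖f x‖ₑ ^ q = (g x : ℝ≥0∞) ^ q
    rw [enorm_eq_nnnorm, hx]
  have h2 : ∫⁻ x, ∫⁻ y, edist (g x) (g y) ^ p * (edist x y ^ ((n : ℝ) + s * p))⁻¹ ∂μ ∂μ ≤
      ∫⁻ x, ∫⁻ y, ‖f x - f y‖ₑ ^ p / ‖x - y‖ₑ ^ ((n : ℝ) + s * p) ∂μ ∂μ := by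
    refine lintegral_mono_ae (hae.mono fun x hx => ?_)
    refine lintegral_mono_ae (hae.mono fun y hy => ?_)
    simp only at hx hy
    show edist (g x) (g y) ^ p * (edist x y ^ ((n : ℝ) + s * p))⁻¹ ≤
      ‖f x - f y‖ₑ ^ p / ‖x - y‖ₑ ^ ((n : ℝ) + s * p)
    have hle : edist (g x) (g y) ≤ ‖f x - f y‖ₑ := by
      rw [← hx, ← hy, edist_nndist, enorm_eq_nnnorm]
      exact ENNReal.coe_le_coe.2 (nndist_nnnorm_nnnorm_le _ _)
    rw [div_eq_mul_inv, edist_eq_enorm_sub]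
    exact mul_le_mul_left (ENNReal.rpow_le_rpow hle hp0.le) _
  calc (∫⁻ x, ‖f x‖ₑ ^ q ∂μ) ^ γ = (∫⁻ x, (g x : ℝ≥0∞) ^ q ∂μ) ^ γ := by rw [h1]
    _ ≤ C * ∫⁻ x, ∫⁻ y, edist (g x) (g y) ^ p * (edist x y ^ ((n : ℝ) + s * p))⁻¹ ∂μ ∂μ :=
        hmain g hgm hgsupp
    _ ≤ _ := mul_le_mul_right h2 C

/-- **Theorem 6.5, printed hypotheses** (measurable — here a.e.-strongly measurable — and compactly
supported `f`): `‖f‖_{L^{p⋆}}^p ≤ C [f]^p_{W^{s,p}}` in the lower-integral form of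
`exists_lintegral_rpow_enorm_le_mul_gagliardo`. [cite: DinezzaPalatucciValdinoci2012, Theorem 6.5] -/
theorem exists_lintegral_rpow_enorm_le_mul_gagliardo_of_hasCompactSupport
    (hn : 0 < Module.finrank ℝ E) {s p : ℝ} (hs0 : 0 < s) (hs1 : s < 1) (hp : 1 ≤ p)
    (hsp : s * p < Module.finrank ℝ E) :
    ∃ C : ℝ≥0∞, C ≠ ⊤ ∧ ∀ (f : E → F), AEStronglyMeasurable f μ → HasCompactSupport f →
      (∫⁻ x, ‖f x‖ₑ ^ ((Module.finrank ℝ E : ℝ) * p / ((Module.finrank ℝ E : ℝ) - s * p)) ∂μ) ^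
          (((Module.finrank ℝ E : ℝ) - s * p) / (Module.finrank ℝ E : ℝ)) ≤
        C * ∫⁻ x, ∫⁻ y, ‖f x - f y‖ₑ ^ p / ‖x - y‖ₑ ^ ((Module.finrank ℝ E : ℝ) + s * p) ∂μ ∂μ := by
  obtain ⟨C, hC, h⟩ := exists_lintegral_rpow_enorm_le_mul_gagliardo μ (F := F) hn hs0 hs1 hp hsp
  exact ⟨C, hC, fun f hf hcs => h f hf
    ((measure_mono (subset_tsupport f)).trans_lt hcs.isCompact.measure_lt_top).ne⟩

/-- **Theorem 6.5 in `L^{p⋆}`-seminorm form**: `‖f‖_{L^{p⋆}(μ)} ≤ (C [f]^p_{W^{s,p}})^{1/p}` for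
a.e.-strongly measurable `f` with support of finite measure (`p⋆ = np/(n−sp)`, so that
`‖f‖_{L^{p⋆}} = ((∫ ‖f‖^{p⋆})^{(n−sp)/n})^{1/p}`). [cite: DinezzaPalatucciValdinoci2012, Theorem 6.5] -/
theorem exists_eLpNorm_le_mul_gagliardo_rpow (hn : 0 < Module.finrank ℝ E) {s p : ℝ}
    (hs0 : 0 < s) (hs1 : s < 1) (hp : 1 ≤ p) (hsp : s * p < Module.finrank ℝ E) :
    ∃ C : ℝ≥0∞, C ≠ ⊤ ∧ ∀ (f : E → F), AEStronglyMeasurable f μ → μ (Function.support f) ≠ ⊤ →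
      eLpNorm f (ENNReal.ofReal ((Module.finrank ℝ E : ℝ) * p / ((Module.finrank ℝ E : ℝ) - s * p))) μ ≤
        (C * ∫⁻ x, ∫⁻ y, ‖f x - f y‖ₑ ^ p / ‖x - y‖ₑ ^ ((Module.finrank ℝ E : ℝ) + s * p) ∂μ ∂μ) ^
          (1 / p) := by
  obtain ⟨C, hC, h⟩ := exists_lintegral_rpow_enorm_le_mul_gagliardo μ (F := F) hn hs0 hs1 hp hsp
  refine ⟨C, hC, fun f hf hsupp => ?_⟩
  have hp0 : 0 < p := by linarith
  set n : ℕ := Module.finrank ℝ E with hn_def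
  have hnpos : (0 : ℝ) < n := by exact_mod_cast hn
  have hnsp : 0 < (n : ℝ) - s * p := sub_pos.2 hsp
  set q : ℝ := (n : ℝ) * p / ((n : ℝ) - s * p) with hq
  have hq0 : 0 < q := by positivity
  set γ : ℝ := ((n : ℝ) - s * p) / (n : ℝ) with hγ
  have hγq : 1 / q = γ * (1 / p) := by
    rw [hq, hγ]
    field_simp
  have hq_ne0 : ENNReal.ofReal q ≠ 0 := (ENNReal.ofReal_pos.2 hq0).ne'
  rw [eLpNorm_eq_lintegral_rpow_enorm_toReal hq_ne0 ENNReal.ofReal_ne_top, ENNReal.toReal_ofReal hq0.le, hγq,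
    ENNReal.rpow_mul]
  exact ENNReal.rpow_le_rpow (h f hf hsupp) (by positivity)

/-- **The case `(n, s, p, p⋆) = (3, ½, 2, 3)` on `ℝ³`** (the `Ḣ^{1/2}`-Gagliardo energy
`∬ ‖f x − f y‖² / ‖x − y‖⁴` controls `‖f‖²_{L³}`): there is `C < ∞` such that for every
a.e.-strongly measurable `f : ℝ³ → F` with support of finite Lebesgue measure,
`(∫ ‖f‖³)^{2/3} ≤ C ∬ ‖f x − f y‖² / ‖x − y‖⁴`. [cite: DinezzaPalatucciValdinoci2012, Theorem 6.5] -/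
theorem exists_lintegral_cube_le_mul_gagliardo_R3 :
    ∃ C : ℝ≥0∞, C ≠ ⊤ ∧ ∀ (f : EuclideanSpace ℝ (Fin 3) → F), AEStronglyMeasurable f volume →
      volume (Function.support f) ≠ ⊤ →
      (∫⁻ x, ‖f x‖ₑ ^ (3 : ℝ)) ^ ((2 : ℝ) / 3) ≤
        C * ∫⁻ x, ∫⁻ y, ‖f x - f y‖ₑ ^ (2 : ℝ) / ‖x - y‖ₑ ^ (4 : ℝ) := by
  have hn3 : Module.finrank ℝ (EuclideanSpace ℝ (Fin 3)) = 3 := by simp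
  have hn : 0 < Module.finrank ℝ (EuclideanSpace ℝ (Fin 3)) := by rw [hn3]; norm_num
  obtain ⟨C, hC, h⟩ := exists_lintegral_rpow_enorm_le_mul_gagliardo
    (volume : Measure (EuclideanSpace ℝ (Fin 3))) (F := F) hn (s := 1 / 2) (p := 2)
    (by norm_num) (by norm_num) (by norm_num) (by rw [hn3]; norm_num)
  refine ⟨C, hC, fun f hf hsupp => ?_⟩
  have h' := h f hf hsupp
  have e1 : ((Module.finrank ℝ (EuclideanSpace ℝ (Fin 3)) : ℝ) * 2 /
      ((Module.finrank ℝ (EuclideanSpace ℝ (Fin 3)) : ℝ) - 1 / 2 * 2)) = 3 := by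
    rw [hn3]; norm_num
  have e2 : (((Module.finrank ℝ (EuclideanSpace ℝ (Fin 3)) : ℝ) - 1 / 2 * 2) /
      (Module.finrank ℝ (EuclideanSpace ℝ (Fin 3)) : ℝ)) = 2 / 3 := by
    rw [hn3]; norm_num
  have e3 : ((Module.finrank ℝ (EuclideanSpace ℝ (Fin 3)) : ℝ) + 1 / 2 * 2) = 4 := by
    rw [hn3]; norm_num
  rw [e1, e2, e3] at h'
  exact h'

end Main

end DiNezzaPalatucciValdinoci2012

end Literature.Analysis.FunctionSpaces
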